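import Summits.ResolutionOfSingularities.ResolutionOfSingularities.Theorems.PurelyInseparableDim4UnitClassTransfer
import HarnessLib
import HarnessLib.Audit.Tags

/-!
# Purely inseparable four-folds — TRIANGULAR TRANSFER THROUGH A RE-PRESENTATION `Q = clean_q(V · θ P) + D`
# (cell `res-dim4-pi`, K2(p) lane, slice B, brick K24a-R1 «read through a unit-class frame», FILE R1-read part 2)

[OURS · counted 0 · cell `res-dim4-pi` · K2(p) lane (holder res-dim4-p-12 g3) · seat res-dim4-p-7 g4 · signature
`coeff_of_diag_rel` of res-dim4-p-1 g4 (bus 2026-08-29T04:06:25Z), generalised to unit class.]  Nothing here proves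
K2(p)/K2(5), `NoIsolatedTrap p p`, or resolution of singularities in dimension ≥ 4 / characteristic `p`.  AI kernel work,
weaker than expert review.

Over `…UnitClassTransfer` (`coeff_aeval_unitClass`, `support_aeval_monomial`): the SN3/SN3b re-presentation relation
`Q = deletePthPowers q (V · aeval θ P) + D`, `D ∈ 𝔪₀ᴹ`, `θ` of unit class along `π` with free letter `f` (`G` with no
`x_f`-term, `x_f`-free monomials of degree `≥ s ≥ 1`), `V` ANY polynomial (in SN3: `V = U^p`).
* `coeff_aeval_unitClass_eq_zero_of_lt`: under the transfer hypothesis at `n`, `θ(P)` has no monomial `b ≤ n♯` with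
  `|b| < |n|` (so the multiplier `V` contributes only `V(0)`).
* **`coeff_of_unitClass_rel`**: `|n| < M`, `n♯` not a `q`-th power exponent ⇒
  `coeff_{n♯} Q = V(0) · (∏ e_i(0)^{n(π i)}) · coeff_n P`; **`coeff_of_diag_rel`** = the diagonal case with `V = U^q`
  (res-dim4-p-1 g4's (R1a) dressed, verbatim up to the unused `U(0) ≠ 0`); **`coeff_of_unitClass_rel_eq_zero_iff`**:
  with units, `coeff_{n♯} Q = 0 ↔ coeff_n P = 0` — the zero / non-zero READINGS transfer letter for letter along `π`.
[cite: Hauser2010, §§F–G (chart expressions; cleaning)] [folklore]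
bears_on: LADDER-RESOLUTION:D157-DOOR2 (res-dim4-pi · K2(p) · slice B · K24a-R1 read).  Supports
stmt-ResolutionOfSingularities-16155 (helper).
-/

set_option linter.dupNamespace false -- mandated namespace of this single-conjunct summit

noncomputable section

namespace Summit.ResolutionOfSingularities.ResolutionOfSingularities.Theorems.PIDim4

namespace SwapNorm

open MvPolynomial Finset
open Literature.AlgebraicGeometry.Resolution
open Literature.AlgebraicGeometry.Resolution.Hauser2010

variable {K : Type} [Field K]

section UnitClass

variable {π : Equiv.Perm (Fin 4)} {f : Fin 4} {θ e : Fin 4 → MvPolynomial (Fin 4) K} {G : MvPolynomial (Fin 4) K}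
  {s : ℕ}

/-- Below `n♯` in degree, `θ(P)` has no monomial `≤ n♯` under the transfer hypothesis (the lower shadows of `n♯` are
empty). [folklore] -/
theorem coeff_aeval_unitClass_eq_zero_of_lt (hθi : ∀ i, i ≠ f → θ (π i) = X i * e i)
    (hθf : θ (π f) = X f * e f + G) (hG : ∀ d ∈ G.support, d f = 0 → s ≤ d.degree) (hs : 1 ≤ s)
    (P : MvPolynomial (Fin 4) K) {n : Fin 4 →₀ ℕ}
    (hlow : ∀ (m₀ : Fin 4 →₀ ℕ) (j : ℕ), m₀ ≤ n → m₀.degree + j * s ≤ n.degree →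
      m₀ + Finsupp.single (π f) j ≠ n → coeff (m₀ + Finsupp.single (π f) j) P = 0)
    {b : Fin 4 →₀ ℕ} (hb : b ≤ Finsupp.mapDomain π.symm n) (hbn : b.degree < n.degree) :
    coeff b (aeval θ P) = 0 := by
  classical
  conv_lhs => rw [as_sum P, map_sum, coeff_sum]
  refine Finset.sum_eq_zero fun m hm => ?_
  by_contra hne
  obtain ⟨i, j, hij, hle, hdeg⟩ := support_aeval_monomial hθi hθf hG hs m (coeff m P) _ (mem_support_iff.mpr hne)
  have hle' : m.erase (π f) + Finsupp.single (π f) i ≤ n := by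
    rw [← mapDomain_perm_le_iff π, Finsupp.mapDomain_add, mapDomain_perm_single]; exact hle.trans hb
  have hjs : j ≤ j * s := Nat.le_mul_of_pos_right j hs
  have hdeg' : (m.erase (π f) + Finsupp.single (π f) i).degree + j * s ≤ n.degree := by
    rw [map_add, Finsupp.degree_single]; omega
  have hm' : m.erase (π f) + Finsupp.single (π f) i + Finsupp.single (π f) j = m := by
    rw [add_assoc, ← Finsupp.single_add, hij, Finsupp.erase_add_single]
  have hmn : m ≠ n := by
    rintro rfl
    have hdm : m.degree = (m.erase (π f)).degree + i + j := by
      conv_lhs => rw [← hm']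
      rw [map_add, map_add, Finsupp.degree_single, Finsupp.degree_single]
    omega
  have h0 := hlow _ j hle' hdeg' (by rw [hm']; exact hmn)
  rw [hm'] at h0
  exact (mem_support_iff.mp hm) h0

/-- **TRANSFER THROUGH A RE-PRESENTATION**: `Q = clean_q(V · θ P) + D`, `D ∈ 𝔪₀ᴹ`, `|n| < M`, `n♯` not a `q`-th power
exponent, and the transfer hypothesis at `n` ⇒ `coeff_{n♯} Q = V(0) · (∏ e_i(0)^{n(πi)}) · coeff_n P`.
[cite: Hauser2010, §§F–G (cleaning)] [folklore] -/
theorem coeff_of_unitClass_rel (q : ℕ) (hθi : ∀ i, i ≠ f → θ (π i) = X i * e i) (hθf : θ (π f) = X f * e f + G)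
    (hG1 : coeff (Finsupp.single f 1) G = 0) (hG : ∀ d ∈ G.support, d f = 0 → s ≤ d.degree) (hs : 1 ≤ s)
    {V D Q : MvPolynomial (Fin 4) K} {M : ℕ} (hD : D ∈ originIdeal K ^ M)
    {P : MvPolynomial (Fin 4) K} (hrel : Q = deletePthPowers q (V * aeval θ P) + D) {n : Fin 4 →₀ ℕ}
    (hlow : ∀ (m₀ : Fin 4 →₀ ℕ) (j : ℕ), m₀ ≤ n → m₀.degree + j * s ≤ n.degree →
      m₀ + Finsupp.single (π f) j ≠ n → coeff (m₀ + Finsupp.single (π f) j) P = 0)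
    (hnM : n.degree < M) (hnq : ¬ IsPthPowerExponent q (Finsupp.mapDomain π.symm n)) :
    coeff (Finsupp.mapDomain π.symm n) Q =
      constantCoeff V * (∏ i, constantCoeff (e i) ^ n (π i)) * coeff n P := by
  classical
  have hDn : coeff (Finsupp.mapDomain π.symm n) D = 0 :=
    (IsolationCert.mem_originIdeal_pow_iff M D).mp hD _ (by rw [ResCone.degree_mapDomain_perm]; exact hnM)
  rw [hrel, coeff_add, hDn, add_zero, coeff_deletePthPowers, if_neg hnq, coeff_mul,
    Finset.sum_eq_single ((0 : Fin 4 →₀ ℕ), Finsupp.mapDomain π.symm n)]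
  · rw [coeff_aeval_unitClass hθi hθf hG1 hG hs P hlow, ← constantCoeff_eq, mul_assoc]
  · rintro ⟨u, b⟩ hanti hne
    have hsum : u + b = Finsupp.mapDomain π.symm n := Finset.HasAntidiagonal.mem_antidiagonal.mp hanti
    have hu : u ≠ 0 := by
      rintro rfl; apply hne; rw [zero_add] at hsum; rw [hsum]
    have hb : b ≤ Finsupp.mapDomain π.symm n := by rw [← hsum]; exact le_add_self
    have hbn : b.degree < n.degree := by
      have h := congrArg Finsupp.degree hsum
      rw [map_add, ResCone.degree_mapDomain_perm] at h
      have : u.degree ≠ 0 := fun h0 => hu ((Finsupp.degree_eq_zero_iff u).mp h0)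
      omega
    rw [coeff_aeval_unitClass_eq_zero_of_lt hθi hθf hG hs P hlow hb hbn, mul_zero]
  · intro h
    exact absurd (Finset.HasAntidiagonal.mem_antidiagonal.mpr (zero_add _)) h

/-- **(R1a dressed) TRANSFER FOR A DIAGONAL SUBSTITUTION THROUGH A RE-PRESENTATION** (res-dim4-p-1 g4's signature):
`Q = clean_q(U^q · θ P) + D` with `θ` diagonal ⇒ `coeff_{n♯} Q = U(0)^q · (∏ e_i(0)^{n(πi)}) · coeff_n P` whenever the
lower coefficients `n' ≤ n`, `n' ≠ n` of `P` vanish, `|n| < M` and `n♯` is not a `q`-th power exponent.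
[cite: Hauser2010, §§F–G (cleaning)] [folklore] -/
theorem coeff_of_diag_rel (q : ℕ) (hθ : ∀ i, θ (π i) = X i * e i) {U D Q : MvPolynomial (Fin 4) K} {M : ℕ}
    (hD : D ∈ originIdeal K ^ M) {P : MvPolynomial (Fin 4) K}
    (hrel : Q = deletePthPowers q (U ^ q * aeval θ P) + D) {n : Fin 4 →₀ ℕ}
    (hlow : ∀ n' ≤ n, n' ≠ n → coeff n' P = 0) (hnM : n.degree < M)
    (hnq : ¬ IsPthPowerExponent q (Finsupp.mapDomain π.symm n)) :
    coeff (Finsupp.mapDomain π.symm n) Q =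
      constantCoeff U ^ q * (∏ i, constantCoeff (e i) ^ n (π i)) * coeff n P := by
  have hθf : θ (π 0) = X 0 * e 0 + 0 := by rw [hθ 0, add_zero]
  rw [← map_pow]
  refine coeff_of_unitClass_rel q (f := 0) (s := n.degree + 1) (fun i _ => hθ i) hθf (coeff_zero _)
    (fun d hd => absurd hd (by simp)) (Nat.succ_le_succ (Nat.zero_le _)) hD hrel (fun m₀ j hle hdeg hne => ?_) hnM hnq
  rcases Nat.eq_zero_or_pos j with rfl | hj
  · rw [Finsupp.single_zero, add_zero] at hne ⊢
    exact hlow m₀ hle hne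
  · exfalso
    have : n.degree + 1 ≤ j * (n.degree + 1) := Nat.le_mul_of_pos_left _ hj
    omega

/-- **ZERO / NON-ZERO READINGS TRANSFER**: with units (`e_i(0) ≠ 0`, `V(0) ≠ 0`), `coeff_{n♯} Q = 0 ↔ coeff_n P = 0`.
[folklore] -/
theorem coeff_of_unitClass_rel_eq_zero_iff (q : ℕ) (hθi : ∀ i, i ≠ f → θ (π i) = X i * e i)
    (hθf : θ (π f) = X f * e f + G) (he : ∀ i, constantCoeff (e i) ≠ 0)
    (hG1 : coeff (Finsupp.single f 1) G = 0) (hG : ∀ d ∈ G.support, d f = 0 → s ≤ d.degree) (hs : 1 ≤ s)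
    {V D Q : MvPolynomial (Fin 4) K} {M : ℕ} (hV : constantCoeff V ≠ 0) (hD : D ∈ originIdeal K ^ M)
    {P : MvPolynomial (Fin 4) K} (hrel : Q = deletePthPowers q (V * aeval θ P) + D) {n : Fin 4 →₀ ℕ}
    (hlow : ∀ (m₀ : Fin 4 →₀ ℕ) (j : ℕ), m₀ ≤ n → m₀.degree + j * s ≤ n.degree →
      m₀ + Finsupp.single (π f) j ≠ n → coeff (m₀ + Finsupp.single (π f) j) P = 0)
    (hnM : n.degree < M) (hnq : ¬ IsPthPowerExponent q (Finsupp.mapDomain π.symm n)) :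
    coeff (Finsupp.mapDomain π.symm n) Q = 0 ↔ coeff n P = 0 := by
  rw [coeff_of_unitClass_rel q hθi hθf hG1 hG hs hD hrel hlow hnM hnq, mul_eq_zero, mul_eq_zero, or_iff_right]
  exact not_or.mpr ⟨hV, Finset.prod_ne_zero_iff.mpr fun i _ => pow_ne_zero _ (he i)⟩

end UnitClass

end SwapNorm

end Summit.ResolutionOfSingularities.ResolutionOfSingularities.Theorems.PIDim4

end
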